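import Literature.NumberTheory.PAdicHodge.SenCocycleDescentBase
import HarnessLib

/-!
# Uniqueness of Sen's `K_n`-structure (Berger–Colmez Lemme 3.2.5 ⇒ Prop. 3.3.1; Brinon–Conrad Thm. 15.1.2)

Companion of `SenCocycleDescentBase` (existence: a small continuous cocycle `U : G₀ → GL_d(ℂ_F)` is
cohomologous to a cocycle `V` trivial on `H₀` with values in `GL_d(K_n)`). This file proves the UNIQUENESS of
the descended structure: if `V` and `V'` are two such descended cocycles (trivial on `H₀ = ker χ`, with
`γ_n`-components `V_{γ_n}, V'_{γ_n} ∈ M_d(K_n)` that are `r`-close to `1` for some `r < |p|²`) and `M ∈ GL_d(ℂ_F)`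
intertwines them, `V'_σ = M⁻¹ V_σ σ(M)` for all `σ ∈ G₀`, then `M ∈ M_d(K_n)`: the `K_n`-span of the
descended basis (Sen's `D_Sen`) does not depend on the choices. Proof: `M` is `H₀`-invariant (compare at
`τ ∈ H₀`), hence in `M_d(X)` by Ax–Sen–Tate; at `σ = γ_n`, `γ_n(M) = V_{γ_n}⁻¹ M V'_{γ_n}` and Berger–Colmez
Lemme 3.2.5 (`TateTrace.matrix_gen_smul_eq_of_map_eq_mul_mul`) forces `γ_n(M) = M`, i.e. `M ∈ M_d(K_n)`
(`X^{γ_n} = K_n`). Everything is proved; no named facts.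

References: Berger–Colmez, Astérisque 319 (2008), Lemme 3.2.5, Prop. 3.3.1 [BergerColmez2008];
Brinon–Conrad (2009), Thm. 15.1.2 (uniqueness of `D_Sen`) [BrinonConrad2009]; S. Sen (1980), Thm. 2 [Sen1980].
-/

noncomputable section

open ValuativeRel Field UniformSpace Filter Topology Finset

open scoped IntermediateField

namespace Literature.NumberTheory.PAdicHodge

open Literature.NumberTheory.GaloisRepresentations
open Literature.NumberTheory.GaloisRepresentations.IsNonarchimedeanLocalField
open CyclotomicTower

variable {F : Type} [Field F] [ValuativeRel F] [TopologicalSpace F] [IsNonarchimedeanLocalField F]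
  [CharZero F] {p : ℕ} [Fact p.Prime] (hp : valuation F p < 1)

namespace TateTrace

variable {m : Type} [Fintype m] [DecidableEq m]

/-! ### Toolkit -/

/-- `X` as a subring of `ℂ_F` (existence only). [folklore] -/
private theorem exists_subring_coe_eq_X' :
    ∃ R : Subring (CompletedAlgClosure F), (R : Set (CompletedAlgClosure F)) = X hp :=
  ⟨{ carrier := X hp
     mul_mem' := fun ha hb => mul_mem_X hp ha hb
     one_mem' := one_mem_X hp
     add_mem' := fun ha hb => add_mem_X hp ha hb
     zero_mem' := zero_mem_X hp
     neg_mem' := fun ha => neg_mem_X hp ha }, rfl⟩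

/-- The inverse of a matrix over the subfield `X` is over `X`. [folklore] -/
private theorem inv_apply_mem_X' {A : Matrix m m (CompletedAlgClosure F)} (hA : ∀ i j, A i j ∈ X hp)
    (i j : m) : A⁻¹ i j ∈ X hp := by
  obtain ⟨R, hR⟩ := exists_subring_coe_eq_X' hp
  have hmem : ∀ i j, A i j ∈ R := fun i j => by rw [← SetLike.mem_coe, hR]; exact hA i j
  set A' : Matrix m m R := fun i j => ⟨A i j, hmem i j⟩ with hA'
  have hAA' : R.subtype.mapMatrix A' = A := by
    ext i j; rfl
  have hdet : A.det ∈ X hp := by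
    rw [← hR, SetLike.mem_coe, ← hAA', ← RingHom.map_det]
    exact (A'.det).2
  have hadj : A.adjugate i j ∈ X hp := by
    rw [← hR, SetLike.mem_coe, ← hAA', ← RingHom.map_adjugate]
    exact (A'.adjugate i j).2
  rw [Matrix.inv_def, Matrix.smul_apply, smul_eq_mul, Ring.inverse_eq_inv]
  exact mul_mem_X hp (inv_mem_X hp hdet) hadj

/-- `γ_n` fixes (the image in `ℂ_F` of) `K n`. [folklore] -/
private theorem gen_smul_coe_eq_of_mem_K {n : ℕ} (hn : 1 ≤ n) {x : NormedAlgClosure F} (hx : x ∈ K hp n) :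
    gen hp n • (x : CompletedAlgClosure F) = x := by
  have h := gen_smul_zeta_self hp hn
  have h1 : gen hp n • zeta F p n = (1 : BaseGaloisGroup hp) • zeta F p n := by rw [h, one_smul]
  have h2 := smul_eq_smul_of_smul_zeta_eq hp h1 hx
  rw [one_smul] at h2
  rw [CompletedAlgClosure.base_smul_coe, h2]

omit [Fintype m] [DecidableEq m] in
/-- Entries in (the image of) `K n` are in `X` and `γ_n`-fixed. [folklore] -/
private theorem mem_X_and_gen_smul_eq_of_mem_image_K {n : ℕ} (hn : 1 ≤ n)
    {A : Matrix m m (CompletedAlgClosure F)}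
    (hA : ∀ i j, A i j ∈ ((↑) : NormedAlgClosure F → CompletedAlgClosure F) '' (K hp n : Set (NormedAlgClosure F))) :
    (∀ i j, A i j ∈ X hp) ∧ ∀ i j, gen hp n • A i j = A i j := by
  refine ⟨fun i j => ?_, fun i j => ?_⟩
  · obtain ⟨y, hy, hyx⟩ := hA i j
    rw [← hyx]
    exact S_subset_X hp (coe_mem_S hp (K_le_Kinf hp n hy))
  · obtain ⟨y, hy, hyx⟩ := hA i j
    rw [← hyx]
    exact gen_smul_coe_eq_of_mem_K hp hn hy

/-! ### Uniqueness -/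

/-- ★ **Uniqueness of Sen's `K_n`-structure (Berger–Colmez Lemme 3.2.5 / Prop. 3.3.1; Brinon–Conrad
Thm. 15.1.2, uniqueness).** Let `V, V' : G₀ → M_d(ℂ_F)` be trivial on `H₀ = ker χ` with `γ_n`-components
`V_{γ_n}, V'_{γ_n}` having all entries in `K_n` and `‖V_{γ_n} − 1‖, ‖V'_{γ_n} − 1‖ ≤ r < |p|²` entrywise
(`n ≥ 2`). If `M ∈ GL_d(ℂ_F)` satisfies `V'_σ = M⁻¹ V_σ σ(M)` for all `σ ∈ G₀`, then every entry of `M` lies in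
`K_n`. (No cocycle condition is needed.) [cite: BergerColmez2008, Lemme 3.2.5 and Prop. 3.3.1]
[cite: BrinonConrad2009, Thm. 15.1.2] [cite: Sen1980, Thm. 2] -/
theorem baseGalois_GL_cocycle_descent_unique {n : ℕ} (hn : 2 ≤ n)
    {V V' : BaseGaloisGroup hp → Matrix m m (CompletedAlgClosure F)}
    (hVH : ∀ τ : BaseGaloisGroup hp, τ ∈ (BaseGaloisGroup.baseCyclotomicCharacter hp).ker → V τ = 1)
    (hV'H : ∀ τ : BaseGaloisGroup hp, τ ∈ (BaseGaloisGroup.baseCyclotomicCharacter hp).ker → V' τ = 1)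
    (hVK : ∀ i j, V (gen hp n) i j ∈
      ((↑) : NormedAlgClosure F → CompletedAlgClosure F) '' (K hp n : Set (NormedAlgClosure F)))
    (hV'K : ∀ i j, V' (gen hp n) i j ∈
      ((↑) : NormedAlgClosure F → CompletedAlgClosure F) '' (K hp n : Set (NormedAlgClosure F)))
    {r : ℝ} (hr : r < ‖(p : PadicBase F p hp)‖ ^ 2) (hVr : ∀ i j, ‖(V (gen hp n) - 1) i j‖ ≤ r)
    (hV'r : ∀ i j, ‖(V' (gen hp n) - 1) i j‖ ≤ r)
    {M : Matrix m m (CompletedAlgClosure F)} (hM : IsUnit M.det)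
    (hrel : ∀ σ : BaseGaloisGroup hp, V' σ = M⁻¹ * V σ * M.map fun x => σ • x) :
    ∀ i j, M i j ∈ ((↑) : NormedAlgClosure F → CompletedAlgClosure F) '' (K hp n : Set (NormedAlgClosure F)) := by
  rcases isEmpty_or_nonempty m with hm | ⟨⟨i₀⟩⟩
  · exact fun i => isEmptyElim i
  have hπ0 : 0 < ‖(p : PadicBase F p hp)‖ := norm_pos_iff.mpr (by exact_mod_cast (Fact.out : p.Prime).ne_zero)
  have hπ1 : ‖(p : PadicBase F p hp)‖ < 1 := PadicBase.norm_p_lt_one hp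
  have hr0 : 0 ≤ r := (norm_nonneg _).trans (hVr i₀ i₀)
  have hr1 : r < 1 := hr.trans (pow_lt_one₀ hπ0.le hπ1 two_ne_zero)
  obtain ⟨hVX, hVγ⟩ := mem_X_and_gen_smul_eq_of_mem_image_K hp (by omega) hVK
  obtain ⟨hV'X, hV'γ⟩ := mem_X_and_gen_smul_eq_of_mem_image_K hp (by omega) hV'K
  -- (1) `M` is `H₀`-invariant, hence over `X`
  have hMfix : ∀ τ : BaseGaloisGroup hp, τ ∈ (BaseGaloisGroup.baseCyclotomicCharacter hp).ker →
      (M.map fun x => τ • x) = M := by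
    intro τ hτ
    have h := hrel τ
    rw [hV'H τ hτ, hVH τ hτ, Matrix.mul_one] at h
    have h2 : M * (M⁻¹ * M.map fun x => τ • x) = M * 1 := by rw [← h]
    rwa [Matrix.mul_nonsing_inv_cancel_left M _ hM, Matrix.mul_one] at h2
  have hMX : ∀ i j, M i j ∈ X hp := by
    intro i j
    rw [← fixedPoints_eq_X hp]
    intro g hg
    have hgk : g ∈ (BaseGaloisGroup.baseCyclotomicCharacter hp).ker :=
      (TateSen.mem_baseKer_iff_forall_smul_zeta hp g).mpr hg
    have h := congrFun (congrFun (hMfix g hgk) i) j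
    rwa [Matrix.map_apply] at h
  -- (2) `V_{γ_n}⁻¹`: invertible, over `X`, `γ_n`-fixed, close to `1`
  obtain ⟨hVdet, hVinv1⟩ := isUnit_det_and_norm_inv_sub_one_le hr0 hr1 hVr
  have hVinvX : ∀ i j, (V (gen hp n))⁻¹ i j ∈ X hp := inv_apply_mem_X' hp hVX
  set f : CompletedAlgClosure F →+* CompletedAlgClosure F :=
    MulSemiringAction.toRingHom (BaseGaloisGroup hp) (CompletedAlgClosure F) (gen hp n) with hf_def
  have hf : (fun x : CompletedAlgClosure F => gen hp n • x) = ⇑f := by funext x; simp [hf_def]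
  have hVmap : (V (gen hp n)).map ⇑f = V (gen hp n) := by
    ext i j; rw [Matrix.map_apply, ← hf]; exact hVγ i j
  have hVinvmap : ((V (gen hp n))⁻¹).map ⇑f = (V (gen hp n))⁻¹ := by
    refine (Matrix.inv_eq_left_inv ?_).symm
    rw [← hVmap, ← Matrix.map_mul, hVmap, Matrix.nonsing_inv_mul _ hVdet,
      Matrix.map_one f (map_zero f) (map_one f)]
  have hVinvγ : ∀ i j, gen hp n • (V (gen hp n))⁻¹ i j = (V (gen hp n))⁻¹ i j := by
    intro i j
    have h := congrFun (congrFun hVinvmap i) j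
    rw [Matrix.map_apply] at h
    simpa [hf_def] using h
  -- (3) `γ_n(M) = V_{γ_n}⁻¹ M V'_{γ_n}`
  have h1 : M * V' (gen hp n) = V (gen hp n) * M.map fun x => gen hp n • x := by
    rw [hrel (gen hp n), Matrix.mul_assoc, Matrix.mul_nonsing_inv_cancel_left M _ hM]
  have hγM : (M.map fun x => gen hp n • x) = (V (gen hp n))⁻¹ * M * V' (gen hp n) := by
    calc (M.map fun x => gen hp n • x)
        = (V (gen hp n))⁻¹ * (V (gen hp n) * M.map fun x => gen hp n • x) :=
          (Matrix.nonsing_inv_mul_cancel_left _ _ hVdet).symm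
      _ = (V (gen hp n))⁻¹ * (M * V' (gen hp n)) := by rw [h1]
      _ = (V (gen hp n))⁻¹ * M * V' (gen hp n) := by rw [Matrix.mul_assoc]
  -- (4) Berger–Colmez Lemme 3.2.5
  have hfix := matrix_gen_smul_eq_of_map_eq_mul_mul hp hn hMX hVinvX hV'X hVinvγ hV'γ hr hVinv1 hV'r hγM
  exact fun i j => mem_image_K_of_gen_smul_eq hp hn (hMX i j) (hfix i j)

end TateTrace

end Literature.NumberTheory.PAdicHodge
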